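import Summits.CriticalPhenomena.PercolationContinuityZ3.Theorems.PercNearOneGluingNearOneGluingExch0
import Summits.CriticalPhenomena.PercolationContinuityZ3.Theorems.PercNearOneGluingAdditiveGluingKnThm2GoodEvents

/-!
# Crux `PercNearOneGluing.NearOneGluing` (stmt-CriticalPhenomena-4574), line `SketchR2I5` —
# U1-M: Kozma–Nitzan's Lemma 2 conditioned on `{y ↮ z}`, with the sharper constant `θ_M`

Lead prover-line-stmt-CriticalPhenomena-4574-c7 (cycle 7, wave 2), stub `stub_u1M`.  Lands
`--supports stmt-CriticalPhenomena-4574`; no definitions, no named facts.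

## Content

Finite weighted graph on `Fin n`, `μ = prodBernoulli w` on `Set (Sym2 (Fin n))`, `{u ↔ v} = openConn u v`,
`C_s(ω) = openEdgeCluster ω s`; `x, y, z` pairwise distinct, `o` arbitrary.  Notation:
`D := {y ↮ z}`, `D″ := {y ↮ x} ∩ {y ↮ z}`, `M := {x ↮ z} ∩ {y ↮ z}`, `N := {x ↮ y} ∩ {x ↮ z} ∩ {y ↮ z}`,
`J := {o ↔ x} ∪ {o ↔ y}`, `θ_M := μ({o↔x} ∩ N) / μ(N)`.

**U1-M** (`u1M`; registered stub form `stub_u1M`):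
`P(o ↔ y | x ↔ y, y ↮ z) − P(o ↔ y | y ↮ x, y ↮ z) ≥ θ_M`, in the denominator-free form
`μ({o↔x} ∩ N)·μ({x↔y} ∩ D)·μ(D″) ≤ μ(N)·[μ({o↔y} ∩ {x↔y} ∩ D)·μ(D″) − μ({o↔y} ∩ D″)·μ({x↔y} ∩ D)]`,
a conditioned form of Kozma–Nitzan's Lemma 2 (`φ(a) + φ(c) ≤ φ(ac)`, arXiv:2401.12397 p. 6).

Proof.
1. `u1M_harrisM` — van den Berg–Häggström–Kahn's Thm. 1.3 for the open cluster `C_x ∪ C_y` of the SET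
   `{x, y}` given `{x, y} ↮ {z}` (`= M`) (tree theorem `stub_bhkSets`, part (i)) with the increasing cluster
   functions `1_J` and `1{x↔y}` (both read off `C_x ∪ C_y`, `mem_openConn_iff_of_cluster_subset`):
   `μ(M ∩ J)·μ(M ∩ {x↔y}) ≤ μ(M)·μ(M ∩ (J ∩ {x↔y}))`.
2. `u1M_bhk14` — BHK's Thm. 1.4 for the clusters of `{y}` and of `{x, z}` given `{y} ↮ {x, z}` (`= D″`)
   (`stub_bhkSets`, part (ii)) with `1{y↔o}` (read off `C_y`) and `1{x↔z}` (read off `C_x ∪ C_z`):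
   `μ(D″)·μ(D″ ∩ ({o↔y} ∩ {x↔z})) ≤ μ(D″ ∩ {o↔y})·μ(D″ ∩ {x↔z})`.  Since `N = D″ ∖ {x↔z}` this is the
   conditional-disconnection tilt `μ({o↔y} ∩ D″)·μ(N) ≤ μ({o↔y} ∩ N)·μ(D″)`.
3. Bookkeeping (`u1M`): `M ∩ {x↔y} = {x↔y} ∩ D`, `M ∩ (J ∩ {x↔y}) = {o↔y} ∩ {x↔y} ∩ D`, `M ∖ {x↔y} = N`,
   and on `N` the events `{o↔x}`, `{o↔y}` are disjoint, so `μ(M) = μ({x↔y} ∩ D) + μ(N)` and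
   `μ(M ∩ J) = μ({o↔y} ∩ {x↔y} ∩ D) + μ({o↔x} ∩ N) + μ({o↔y} ∩ N)`; step 1 becomes
   `(μ({o↔x} ∩ N) + μ({o↔y} ∩ N))·μ({x↔y} ∩ D) ≤ μ(N)·μ({o↔y} ∩ {x↔y} ∩ D)`, and
   `μ(D″) × (step 1) + μ({x↔y} ∩ D) × (tilt)` is the claim (linear arithmetic).
[cite: VandenbergHaggstromKahn2005, Thm. 1.3 (p. 6), Thm. 1.4 (p. 7)]
[cite: KozmaNitzan2024, Lemma 1 (p. 5), Lemma 2 (p. 6)]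
-/

namespace Summit.CriticalPhenomena.PercolationContinuityZ3.Theorems

open MeasureTheory Set Literature.Probability.LatticeModels Literature.Probability.Percolation
open scoped Classical BigOperators
open Q7ThreeCut

noncomputable section

variable {n : ℕ}

/-! ### A small helper -/

/-- `1`-indicators agree at points with equivalent membership. [folklore] -/
theorem u1M_indicator_one_congr {α β : Type*} {A : Set α} {B : Set β} {a : α} {b : β}
    (h : a ∈ A ↔ b ∈ B) : A.indicator (1 : α → ℝ) a = B.indicator (1 : β → ℝ) b := by
  by_cases hb : b ∈ B
  · rw [indicator_of_mem (h.2 hb), indicator_of_mem hb, Pi.one_apply, Pi.one_apply]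
  · rw [indicator_of_notMem (fun ha => hb (h.1 ha)), indicator_of_notMem hb]

/-! ### Step 1: Harris given `M` (BHK Thm. 1.3 for the source set `{x, y}`) -/

/-- **Harris' inequality given `M = {x ↮ z} ∩ {y ↮ z}`** for `J = {o↔x} ∪ {o↔y}` and `{x ↔ y}`:
`μ(M ∩ J)·μ(M ∩ {x↔y}) ≤ μ(M)·μ(M ∩ (J ∩ {x↔y}))`.  This is van den Berg–Häggström–Kahn's Thm. 1.3
for the open cluster `C_x ∪ C_y` of the set `{x, y}` given `{x, y} ↮ {z}` (tree theorem `stub_bhkSets`,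
part (i)), applied to the increasing cluster functions `1_{{x↔o} ∪ {y↔o}}` and `1{x↔y}`, which evaluated
at `C_x ∪ C_y` are `1_J` and `1{x↔y}` (`mem_openConn_iff_of_cluster_subset`).
[cite: VandenbergHaggstromKahn2005, Thm. 1.3 (p. 6)] -/
theorem u1M_harrisM (w : Sym2 (Fin n) → unitInterval) (o x y z : Fin n) (hxz : x ≠ z) (hyz : y ≠ z) :
    (prodBernoulli w).real (((openConn x z)ᶜ ∩ (openConn y z)ᶜ) ∩ (openConn o x ∪ openConn o y)) *
        (prodBernoulli w).real (((openConn x z)ᶜ ∩ (openConn y z)ᶜ) ∩ openConn x y) ≤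
      (prodBernoulli w).real ((openConn x z)ᶜ ∩ (openConn y z)ᶜ) *
        (prodBernoulli w).real (((openConn x z)ᶜ ∩ (openConn y z)ᶜ) ∩
          ((openConn o x ∪ openConn o y) ∩ openConn x y)) := by
  set μ := prodBernoulli w with hμ
  set M : Set (BondConfig (Fin n)) := (openConn x z)ᶜ ∩ (openConn y z)ᶜ with hM
  obtain ⟨h13, -⟩ := stub_bhkSets
  set F : Set (Sym2 (Fin n)) → ℝ :=
    (openConn x o ∪ openConn y o : Set (BondConfig (Fin n))).indicator 1 with hF
  set G : Set (Sym2 (Fin n)) → ℝ := (openConn x y : Set (BondConfig (Fin n))).indicator 1 with hG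
  have hFm : Monotone F :=
    monotone_indicator_of_isUpperSet ((isUpperSet_openConn x o).union (isUpperSet_openConn y o))
  have hGm : Monotone G := monotone_indicator_of_isUpperSet (isUpperSet_openConn x y)
  -- the conditioning set `{x, y} ↮ {z}` is `M`
  have hD : {ω : BondConfig (Fin n) | ∀ s ∈ ({x, y} : Finset (Fin n)), ∀ t ∈ ({z} : Set (Fin n)),
      ¬ (openGraph ω).Reachable s t} = M := by
    ext ω
    simp only [mem_setOf_eq, Finset.mem_insert, Finset.mem_singleton, forall_eq_or_imp, forall_eq,
      mem_singleton_iff, hM, mem_inter_iff, mem_compl_iff]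
    rfl
  -- the cluster of the set `{x, y}`
  have hC : ∀ ω : BondConfig (Fin n), (⋃ s ∈ ({x, y} : Finset (Fin n)), openEdgeCluster ω s) =
      openEdgeCluster ω x ∪ openEdgeCluster ω y := by
    intro ω
    rw [Finset.set_biUnion_insert, Finset.set_biUnion_singleton]
  have hCω : ∀ ω : BondConfig (Fin n), openEdgeCluster ω x ∪ openEdgeCluster ω y ⊆ ω := fun ω =>
    union_subset (openEdgeCluster_subset ω x) (openEdgeCluster_subset ω y)
  -- pointwise identification of the integrands
  have eF : ∀ ω : BondConfig (Fin n), F (openEdgeCluster ω x ∪ openEdgeCluster ω y) =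
      (openConn o x ∪ openConn o y : Set (BondConfig (Fin n))).indicator 1 ω := by
    intro ω
    have h1 : openEdgeCluster ω x ∪ openEdgeCluster ω y ∈ (openConn x o : Set (BondConfig (Fin n))) ↔
        ω ∈ (openConn o x : Set (BondConfig (Fin n))) :=
      (mem_openConn_iff_of_cluster_subset subset_union_left (hCω ω)).trans
        ⟨fun h => conn_symm h, fun h => conn_symm h⟩
    have h2 : openEdgeCluster ω x ∪ openEdgeCluster ω y ∈ (openConn y o : Set (BondConfig (Fin n))) ↔
        ω ∈ (openConn o y : Set (BondConfig (Fin n))) :=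
      (mem_openConn_iff_of_cluster_subset subset_union_right (hCω ω)).trans
        ⟨fun h => conn_symm h, fun h => conn_symm h⟩
    rw [hF]
    exact u1M_indicator_one_congr (or_congr h1 h2)
  have eG : ∀ ω : BondConfig (Fin n), G (openEdgeCluster ω x ∪ openEdgeCluster ω y) =
      (openConn x y : Set (BondConfig (Fin n))).indicator 1 ω := fun ω =>
    indicator_openConn_of_cluster_subset subset_union_left (hCω ω)
  have eFG : ∀ ω : BondConfig (Fin n),
      F (openEdgeCluster ω x ∪ openEdgeCluster ω y) * G (openEdgeCluster ω x ∪ openEdgeCluster ω y) =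
        ((openConn o x ∪ openConn o y) ∩ openConn x y : Set (BondConfig (Fin n))).indicator 1 ω := by
    intro ω
    rw [eF, eG]
    exact (congrFun (inter_indicator_one (s := (openConn o x ∪ openConn o y : Set (BondConfig (Fin n))))
      (t := openConn x y) (M₀ := ℝ)) ω).symm
  have key := h13 n w {x, y} ({z} : Set (Fin n)) F G hFm hGm (by
    intro s hs
    rw [mem_singleton_iff]
    simp only [Finset.mem_insert, Finset.mem_singleton] at hs
    rcases hs with rfl | rfl
    · exact hxz
    · exact hyz)
  simp only [hD, hC] at key
  simp only [eFG] at key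
  simp only [eF, eG, setIntegral_indicator_one_eq] at key
  exact key

/-! ### Step 2: BHK Thm. 1.4 for the clusters of `y` and of `{x, z}` -/

/-- **BHK Thm. 1.4 for the clusters of `y` and of `{x, z}` given `D″ = {y ↮ x} ∩ {y ↮ z}`**, with
`f = 1{y↔o}` (read off `C_y`) and `g = 1{x↔z}` (read off `C_x ∪ C_z`):
`μ(D″)·μ(D″ ∩ ({o↔y} ∩ {x↔z})) ≤ μ(D″ ∩ {o↔y})·μ(D″ ∩ {x↔z})` (tree theorem `stub_bhkSets`, part (ii)).
[cite: VandenbergHaggstromKahn2005, Thm. 1.4 (p. 7)] -/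
theorem u1M_bhk14 (w : Sym2 (Fin n) → unitInterval) (o x y z : Fin n) (hxy : x ≠ y) (hyz : y ≠ z) :
    (prodBernoulli w).real ((openConn y x)ᶜ ∩ (openConn y z)ᶜ) *
        (prodBernoulli w).real (((openConn y x)ᶜ ∩ (openConn y z)ᶜ) ∩ (openConn o y ∩ openConn x z)) ≤
      (prodBernoulli w).real (((openConn y x)ᶜ ∩ (openConn y z)ᶜ) ∩ openConn o y) *
        (prodBernoulli w).real (((openConn y x)ᶜ ∩ (openConn y z)ᶜ) ∩ openConn x z) := by
  set μ := prodBernoulli w with hμ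
  set D : Set (BondConfig (Fin n)) := (openConn y x)ᶜ ∩ (openConn y z)ᶜ with hD
  obtain ⟨-, h14⟩ := stub_bhkSets
  set F : Set (Sym2 (Fin n)) → ℝ := (openConn y o : Set (BondConfig (Fin n))).indicator 1 with hF
  set G : Set (Sym2 (Fin n)) → ℝ := (openConn x z : Set (BondConfig (Fin n))).indicator 1 with hG
  have hFm : Monotone F := monotone_indicator_of_isUpperSet (isUpperSet_openConn y o)
  have hGm : Monotone G := monotone_indicator_of_isUpperSet (isUpperSet_openConn x z)
  -- the conditioning set `{y} ↮ {x, z}` is `D″`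
  have hD2 : {ω : BondConfig (Fin n) | ∀ s ∈ ({y} : Finset (Fin n)), ∀ t ∈ ({x, z} : Finset (Fin n)),
      ¬ (openGraph ω).Reachable s t} = D := by
    ext ω
    simp only [mem_setOf_eq, Finset.mem_singleton, forall_eq, Finset.mem_insert, forall_eq_or_imp, hD,
      mem_inter_iff, mem_compl_iff]
    rfl
  -- the clusters
  have hCy : ∀ ω : BondConfig (Fin n), (⋃ s ∈ ({y} : Finset (Fin n)), openEdgeCluster ω s) =
      openEdgeCluster ω y := fun ω => Finset.set_biUnion_singleton y _
  have hCxz : ∀ ω : BondConfig (Fin n), (⋃ s ∈ ({x, z} : Finset (Fin n)), openEdgeCluster ω s) =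
      openEdgeCluster ω x ∪ openEdgeCluster ω z := by
    intro ω
    rw [Finset.set_biUnion_insert, Finset.set_biUnion_singleton]
  -- pointwise identification of the integrands
  have eF : ∀ ω : BondConfig (Fin n), F (openEdgeCluster ω y) =
      (openConn o y : Set (BondConfig (Fin n))).indicator 1 ω := by
    intro ω
    rw [hF, indicator_openConn_of_cluster_subset subset_rfl (openEdgeCluster_subset ω y),
      knThm2_openConn_comm y o]
  have eG : ∀ ω : BondConfig (Fin n), G (openEdgeCluster ω x ∪ openEdgeCluster ω z) =
      (openConn x z : Set (BondConfig (Fin n))).indicator 1 ω := fun ω =>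
    indicator_openConn_of_cluster_subset subset_union_left
      (union_subset (openEdgeCluster_subset ω x) (openEdgeCluster_subset ω z))
  have eFG : ∀ ω : BondConfig (Fin n),
      F (openEdgeCluster ω y) * G (openEdgeCluster ω x ∪ openEdgeCluster ω z) =
        (openConn o y ∩ openConn x z : Set (BondConfig (Fin n))).indicator 1 ω := by
    intro ω
    rw [eF, eG]
    exact (congrFun (inter_indicator_one (s := (openConn o y : Set (BondConfig (Fin n))))
      (t := openConn x z) (M₀ := ℝ)) ω).symm
  have key := h14 n w {y} {x, z} F G hFm hGm (by
    simp only [Finset.disjoint_singleton_left, Finset.mem_insert, Finset.mem_singleton, not_or]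
    exact ⟨fun h => hxy h.symm, hyz⟩)
  simp only [hD2, hCy, hCxz] at key
  simp only [eFG] at key
  simp only [eF, eG, setIntegral_indicator_one_eq] at key
  exact key

/-! ### Step 3: assembly -/

/-- **U1-M (Kozma–Nitzan's Lemma 2 conditioned on `{y ↮ z}`, constant `θ_M`).**  For `x, y, z` pairwise
distinct, with `D = {y ↮ z}`, `D″ = {y ↮ x} ∩ {y ↮ z}`, `N = {x ↮ y} ∩ {x ↮ z} ∩ {y ↮ z}`:
`μ({o↔x} ∩ N)·(μ({x↔y} ∩ D)·μ(D″)) ≤ μ(N)·(μ({o↔y} ∩ {x↔y} ∩ D)·μ(D″) − μ({o↔y} ∩ D″)·μ({x↔y} ∩ D))`,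
i.e. `P(o↔y | x↔y, y↮z) − P(o↔y | y↮x, y↮z) ≥ P(o↔x | N)`.  From `u1M_harrisM` (BHK Thm. 1.3 for the
source set `{x, y}`), `u1M_bhk14` (BHK Thm. 1.4 for `y` versus `{x, z}`, giving the tilt
`μ({o↔y} ∩ D″)·μ(N) ≤ μ({o↔y} ∩ N)·μ(D″)`), the set identities `M ∩ {x↔y} = {x↔y} ∩ D`,
`M ∩ (J ∩ {x↔y}) = {o↔y} ∩ {x↔y} ∩ D`, `M ∖ {x↔y} = N = D″ ∖ {x↔z}`, the disjointness of `{o↔x}` and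
`{o↔y}` on `N`, and linear arithmetic.
[cite: KozmaNitzan2024, Lemma 2 (p. 6)]
[cite: VandenbergHaggstromKahn2005, Thm. 1.3 (p. 6), Thm. 1.4 (p. 7)] -/
theorem u1M (w : Sym2 (Fin n) → unitInterval) (o x y z : Fin n) (hxy : x ≠ y) (hxz : x ≠ z)
    (hyz : y ≠ z) :
    (prodBernoulli w).real (openConn o x ∩ ((openConn x y)ᶜ ∩ (openConn x z)ᶜ ∩ (openConn y z)ᶜ)) *
        ((prodBernoulli w).real (openConn x y ∩ (openConn y z)ᶜ) *
          (prodBernoulli w).real ((openConn y x)ᶜ ∩ (openConn y z)ᶜ)) ≤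
      (prodBernoulli w).real ((openConn x y)ᶜ ∩ (openConn x z)ᶜ ∩ (openConn y z)ᶜ) *
        ((prodBernoulli w).real (openConn o y ∩ openConn x y ∩ (openConn y z)ᶜ) *
            (prodBernoulli w).real ((openConn y x)ᶜ ∩ (openConn y z)ᶜ) -
          (prodBernoulli w).real (openConn o y ∩ ((openConn y x)ᶜ ∩ (openConn y z)ᶜ)) *
            (prodBernoulli w).real (openConn x y ∩ (openConn y z)ᶜ)) := by
  have hH := u1M_harrisM w o x y z hxz hyz
  have hB := u1M_bhk14 w o x y z hxy hyz
  set μ := prodBernoulli w with hμ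
  set N : Set (BondConfig (Fin n)) := (openConn x y)ᶜ ∩ (openConn x z)ᶜ ∩ (openConn y z)ᶜ with hN
  set D : Set (BondConfig (Fin n)) := (openConn y x)ᶜ ∩ (openConn y z)ᶜ with hD
  set M : Set (BondConfig (Fin n)) := (openConn x z)ᶜ ∩ (openConn y z)ᶜ with hM
  have hmeas : ∀ s : Set (BondConfig (Fin n)), MeasurableSet s := fun _ => MeasurableSet.of_discrete
  -- set identities around `M`
  have s1 : M ∩ openConn x y = openConn x y ∩ (openConn y z)ᶜ := by
    ext ω
    simp only [hM, mem_inter_iff, mem_compl_iff]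
    constructor
    · rintro ⟨⟨-, hyz'⟩, hxy'⟩
      exact ⟨hxy', hyz'⟩
    · rintro ⟨hxy', hyz'⟩
      exact ⟨⟨fun hxz' => hyz' (conn_trans (conn_symm hxy') hxz'), hyz'⟩, hxy'⟩
  have s2 : M ∩ ((openConn o x ∪ openConn o y) ∩ openConn x y) =
      openConn o y ∩ openConn x y ∩ (openConn y z)ᶜ := by
    ext ω
    simp only [hM, mem_inter_iff, mem_compl_iff, mem_union]
    constructor
    · rintro ⟨⟨-, hyz'⟩, hJ, hxy'⟩
      refine ⟨⟨?_, hxy'⟩, hyz'⟩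
      rcases hJ with hox | hoy
      · exact conn_trans hox hxy'
      · exact hoy
    · rintro ⟨⟨hoy, hxy'⟩, hyz'⟩
      exact ⟨⟨fun hxz' => hyz' (conn_trans (conn_symm hxy') hxz'), hyz'⟩, Or.inr hoy, hxy'⟩
  have s3 : M \ openConn x y = N := by
    ext ω
    simp only [hM, hN, mem_sdiff, mem_inter_iff, mem_compl_iff]
    tauto
  have s4 : (M ∩ (openConn o x ∪ openConn o y)) \ openConn x y =
      (openConn o x ∩ N) ∪ (openConn o y ∩ N) := by
    ext ω
    simp only [hM, hN, mem_sdiff, mem_inter_iff, mem_compl_iff, mem_union]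
    tauto
  have s5 : Disjoint (openConn o x ∩ N) (openConn o y ∩ N) := by
    rw [Set.disjoint_left]
    rintro ω ⟨hox, ⟨⟨hxy', -⟩, -⟩⟩ ⟨hoy, -⟩
    exact hxy' (conn_trans (conn_symm hox) hoy)
  -- set identities around `D″`
  have s6 : (openConn o y ∩ D) ∩ openConn x z = D ∩ (openConn o y ∩ openConn x z) := by
    ext ω
    simp only [mem_inter_iff]
    tauto
  have s7 : (openConn o y ∩ D) \ openConn x z = openConn o y ∩ N := by
    ext ω
    simp only [hD, hN, mem_sdiff, mem_inter_iff, mem_compl_iff, knThm2_openConn_comm y x]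
    tauto
  have s8 : D \ openConn x z = N := by
    ext ω
    simp only [hD, hN, mem_sdiff, mem_inter_iff, mem_compl_iff, knThm2_openConn_comm y x]
    tauto
  -- measure bookkeeping
  have m1 : μ.real M = μ.real (openConn x y ∩ (openConn y z)ᶜ) + μ.real N := by
    have h := measureReal_inter_add_sdiff (μ := μ) (s := M) (hmeas (openConn x y))
    rw [s1, s3] at h
    linarith
  have m2 : μ.real (M ∩ (openConn o x ∪ openConn o y)) =
      μ.real (openConn o y ∩ openConn x y ∩ (openConn y z)ᶜ) +
        (μ.real (openConn o x ∩ N) + μ.real (openConn o y ∩ N)) := by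
    have h := measureReal_inter_add_sdiff (μ := μ) (s := M ∩ (openConn o x ∪ openConn o y))
      (hmeas (openConn x y))
    rw [inter_assoc, s2, s4, measureReal_union s5 (hmeas _)] at h
    linarith
  rw [inter_comm D (openConn o y)] at hB
  have m3 : μ.real (openConn o y ∩ D) =
      μ.real (D ∩ (openConn o y ∩ openConn x z)) + μ.real (openConn o y ∩ N) := by
    have h := measureReal_inter_add_sdiff (μ := μ) (s := openConn o y ∩ D) (hmeas (openConn x z))
    rw [s6, s7] at h
    linarith
  have m4 : μ.real D = μ.real (D ∩ openConn x z) + μ.real N := by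
    have h := measureReal_inter_add_sdiff (μ := μ) (s := D) (hmeas (openConn x z))
    rw [s8] at h
    linarith
  rw [m2, s1, s2, m1] at hH
  -- the tilt `μ({o↔y} ∩ D″)·μ(N) ≤ μ({o↔y} ∩ N)·μ(D″)`
  have hT : μ.real (openConn o y ∩ D) * μ.real N ≤ μ.real (openConn o y ∩ N) * μ.real D := by
    have e1 : μ.real (openConn o y ∩ D) * μ.real D =
        μ.real (openConn o y ∩ D) * μ.real (D ∩ openConn x z) + μ.real (openConn o y ∩ D) * μ.real N := by
      rw [m4]; ring
    have e2 : μ.real (openConn o y ∩ N) * μ.real D =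
        μ.real D * μ.real (openConn o y ∩ D) - μ.real D * μ.real (D ∩ (openConn o y ∩ openConn x z)) := by
      rw [m3]; ring
    nlinarith [e1, e2, hB]
  -- assembly: `μ(D″) × (Harris_M) + μ({x↔y} ∩ D) × (tilt)`
  have h1 := mul_le_mul_of_nonneg_right hH (measureReal_nonneg (μ := μ) (s := D))
  have h2 := mul_le_mul_of_nonneg_right hT
    (measureReal_nonneg (μ := μ) (s := openConn x y ∩ (openConn y z)ᶜ))
  nlinarith [h1, h2]

/-! ### Registered stub form (explicit `∀ n`, fully qualified) -/

/-- Registered stub form of `u1M` (U1-M: `P(o↔y | x↔y, y↮z) − P(o↔y | y↮x, y↮z) ≥ θ_M`, denominators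
cleared), for `x, y, z` pairwise distinct and `o` arbitrary.
[cite: KozmaNitzan2024, Lemma 2 (p. 6)] -/
theorem stub_u1M : ∀ (n : ℕ) (w : Sym2 (Fin n) → unitInterval) (o x y z : Fin n), x ≠ y → x ≠ z → y ≠ z → (Literature.Probability.LatticeModels.prodBernoulli w).real (Literature.Probability.Percolation.openConn o x ∩ ((Literature.Probability.Percolation.openConn x y)ᶜ ∩ (Literature.Probability.Percolation.openConn x z)ᶜ ∩ (Literature.Probability.Percolation.openConn y z)ᶜ)) * ((Literature.Probability.LatticeModels.prodBernoulli w).real (Literature.Probability.Percolation.openConn x y ∩ (Literature.Probability.Percolation.openConn y z)ᶜ) * (Literature.Probability.LatticeModels.prodBernoulli w).real ((Literature.Probability.Percolation.openConn y x)ᶜ ∩ (Literature.Probability.Percolation.openConn y z)ᶜ)) ≤ (Literature.Probability.LatticeModels.prodBernoulli w).real ((Literature.Probability.Percolation.openConn x y)ᶜ ∩ (Literature.Probability.Percolation.openConn x z)ᶜ ∩ (Literature.Probability.Percolation.openConn y z)ᶜ) * ((Literature.Probability.LatticeModels.prodBernoulli w).real (Literature.Probability.Percolation.openConn o y ∩ Literature.Probability.Percolation.openConn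 x y ∩ (Literature.Probability.Percolation.openConn y z)ᶜ) * (Literature.Probability.LatticeModels.prodBernoulli w).real ((Literature.Probability.Percolation.openConn y x)ᶜ ∩ (Literature.Probability.Percolation.openConn y z)ᶜ) - (Literature.Probability.LatticeModels.prodBernoulli w).real (Literature.Probability.Percolation.openConn o y ∩ ((Literature.Probability.Percolation.openConn y x)ᶜ ∩ (Literature.Probability.Percolation.openConn y z)ᶜ)) * (Literature.Probability.LatticeModels.prodBernoulli w).real (Literature.Probability.Percolation.openConn x y ∩ (Literature.Probability.Percolation.openConn y z)ᶜ)) :=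
  fun _ w o x y z hxy hxz hyz => u1M w o x y z hxy hxz hyz

end

end Summit.CriticalPhenomena.PercolationContinuityZ3.Theorems
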